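import Literature.AnabelianGeometry.EtaleTheta.Discharge.Sec4Prop43iOfGaloisSurjNatural
import Literature.AnabelianGeometry.EtaleTheta.Discharge.Sec4GaloisSurjLawsConnectedModel

/-!
# [EtTh] Proposition 4.3 (i) PROVED for the NON-VACUOUS canonical model setting over the connected temperoid
# `B^temp(Π^tp_X)⁰` (re-basing of `prop43_i_mkOfModelCanonical` after the vacuity certificate F-w4d099-1)

S. Mochizuki, *The étale theta function and its Frobenioid-theoretic manifestations*, Publ. RIMS **45**
(2009) [MochizukiEtTh2009], §4, Prop. 4.3 (i) p.90 (PDF; printed p.316); Def. 3.6 (ii) p.76 (the base `D` of a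
tempered Frobenioid is a CONNECTED, totally epimorphic category — print's `B^temp(Π)⁰`).

PROOF-ONLY companion (no definition, no new named fact), seat abc-iut-f-109 (F fact-proving wave, FACT-LIST row
F-0492 `BiKummerSetting.Prop43_i`).  In `Sec4Prop43iOfGaloisSurjNatural.lean` (p428079) the named fact `Prop43_i`
was derived for EVERY setting from `Φ` divisorial and the outer naturality law `GaloisSurjNatural` of Def. 4.1 (ii)
(`prop43_i_of_galoisSurjNatural`), and instantiated at abc-iut-L2-t9's `mkOfModelCanonical` over the FULL temperoid
`BTemp Π^tp_X` (`prop43_i_mkOfModelCanonical(_tree)`).  By abc-iut-w4-d099's kernel certificate F-w4d099-1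
(`Discharge/Sec3TemperedFrobenioidBTempVacuity.lean`: `TemperedFrobenioid.isEmpty_of_bTemp` — no tempered Frobenioid
has the FULL temperoid as base, which contains disconnected objects and so is not totally epimorphic) those two
instances are VACUOUSLY parametrised.  This file gives the CONTENTFUL instance: the canonical model setting over the
connected part `ConnectedPart (BTemp Π^tp_X) = B^temp(Π^tp_X)⁰` fed with the Galois data
`(IsGaloisObj ∘ obj, galoisSurjOf⁰)` of abc-iut-w4-d099's `Sec4GaloisSurjLawsConnectedModel.lean`, whose naturality law
`mkOfModelCanonical_connectedPart_galoisSurjNatural` is a theorem: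
* `prop43_i_mkOfModelCanonical_connectedPart` — `Prop43_i` for EVERY transport `pullFrac` (any saturation slot `NH`,
  any Frobenius-trivial Galois `A_⊙`), given `Φ` divisorial ([FrdI] Thm. 5.2 (ii) standing hypothesis);
* `prop43_i_mkOfModelCanonical_connectedPart_tree` — the same at the tree's vocabulary `treeCatVocab`, NO residual
  hypothesis.
HONEST FRAMING: refereed pre-IUT material ([EtTh] 2009); nothing here bears on, or takes a side on, [IUTchIII]
Cor. 3.12; proved = OUR kernel check of the typed statement at this model.
-/

noncomputable section

namespace Literature.AnabelianGeometry.EtaleTheta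

namespace BiKummerSetting

open CategoryTheory Opposite Literature.AlgebraicGeometry.Frobenioids Literature.AnabelianGeometry.SemiGraphs
  Literature.AnabelianGeometry.SemiGraphs.GaloisObjects

universe u₀ v₀ w

variable {K : Type u₀} [Field K] (X : SemiGraphs.TemperedArithmeticGroup.{u₀} K) {D₀ : Type u₀} [Category.{v₀} D₀]
  {V : FrdIMonoidStub.{w}} {T : RealifiedDivisorMonoids (D₀ := D₀) V}

/-- **[EtTh] Prop. 4.3 (i) PROVED for the canonical model setting over the connected temperoid `B^temp(Π^tp_X)⁰`**
(abc-iut-L2-t9's `mkOfModelCanonical` on a tempered Frobenioid over `ConnectedPart (BTemp Π^tp_X)`, Galois data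
`(IsGaloisObj ∘ obj, galoisSurjOf⁰)`), for EVERY transport `pullFrac`, given only `Φ` divisorial: the naturality input of
`prop43_i_of_galoisSurjNatural` is abc-iut-w4-d099's `mkOfModelCanonical_connectedPart_galoisSurjNatural`.
[cite: MochizukiEtTh2009, Prop 4.3 (i) p.90–91] -/
theorem prop43_i_mkOfModelCanonical_connectedPart {VD : FrdICatStub.{u₀ + 1, u₀, w} (ConnectedPart (BTemp X.Pi))}
    (tf : TemperedFrobenioid T (ConnectedPart (BTemp X.Pi)) VD) (hZ : tf.monoidType = MonoidType.Z)
    (hP : ∀ A : (ConnectedPart (BTemp X.Pi))ᵒᵖ, IsPerfect (tf.Φ.carrier A))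
    (NH : Subgroup (Field.absoluteGaloisGroup K) → tf.category → ℕ+ → Prop) (A₀ : tf.category)
    (hA₀ : PreFrobenioid.IsFrobeniusTrivial tf.toElem A₀) (hA₀' : SemiGraphs.IsGaloisObj A₀.base.obj)
    (hΦd : Objectwise (fun M _ => IsDivisorial M) tf.divisorMonoid)
    (pullFrac : ∀ {A A' : tf.category} (_ : A' ⟶ A), tf.biratUnitsModel A → tf.biratUnitsModel A') :
    (BiKummerSetting.mkOfModelCanonical X tf hZ hP (fun A => SemiGraphs.IsGaloisObj A.obj)
      (fun A h => ((connectedObjects (BTemp X.Pi)).fullyFaithfulι.autMulEquivOfFullyFaithful A).symm.toMonoidHom.comp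
        (galoisSurjOf X.isTempered A.obj h))
      (fun A h => galoisSurjOf_connectedPart_surjective X.isTempered A h) NH A₀ hA₀ hA₀').Prop43_i
      (fun {_ _} φ x => pullFrac φ x) :=
  prop43_i_of_galoisSurjNatural (fun {_ _} φ x => pullFrac φ x) hΦd
    (mkOfModelCanonical_connectedPart_galoisSurjNatural X tf hZ hP NH A₀ hA₀ hA₀')

/-- **[EtTh] Prop. 4.3 (i) PROVED, NO residual hypothesis, for the canonical model setting over `B^temp(Π^tp_X)⁰` at the
tree's vocabulary** (`treeCatVocab`: `Φ` divisorial is automatic), every `pullFrac`, `NH`, `A_⊙`.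
[cite: MochizukiEtTh2009, Prop 4.3 (i) p.90–91] -/
theorem prop43_i_mkOfModelCanonical_connectedPart_tree
    {IsRational IsStrictlyRational : ((ConnectedPart (BTemp X.Pi))ᵒᵖ ⥤ CommMonCat.{w}) → Prop}
    (tf : TemperedFrobenioid T (ConnectedPart (BTemp X.Pi))
      (treeCatVocab (ConnectedPart (BTemp X.Pi)) IsRational IsStrictlyRational))
    (hZ : tf.monoidType = MonoidType.Z) (hP : ∀ A : (ConnectedPart (BTemp X.Pi))ᵒᵖ, IsPerfect (tf.Φ.carrier A))
    (NH : Subgroup (Field.absoluteGaloisGroup K) → tf.category → ℕ+ → Prop) (A₀ : tf.category)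
    (hA₀ : PreFrobenioid.IsFrobeniusTrivial tf.toElem A₀) (hA₀' : SemiGraphs.IsGaloisObj A₀.base.obj)
    (pullFrac : ∀ {A A' : tf.category} (_ : A' ⟶ A), tf.biratUnitsModel A → tf.biratUnitsModel A') :
    (BiKummerSetting.mkOfModelCanonical X tf hZ hP (fun A => SemiGraphs.IsGaloisObj A.obj)
      (fun A h => ((connectedObjects (BTemp X.Pi)).fullyFaithfulι.autMulEquivOfFullyFaithful A).symm.toMonoidHom.comp
        (galoisSurjOf X.isTempered A.obj h))
      (fun A h => galoisSurjOf_connectedPart_surjective X.isTempered A h) NH A₀ hA₀ hA₀').Prop43_i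
      (fun {_ _} φ x => pullFrac φ x) :=
  prop43_i_mkOfModelCanonical_connectedPart X tf hZ hP NH A₀ hA₀ hA₀' tf.isDivisorial_divisorMonoid pullFrac

end BiKummerSetting

end Literature.AnabelianGeometry.EtaleTheta

end
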